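import Mathlib.Analysis.SpecialFunctions.Complex.LogBounds
import Mathlib.Analysis.SpecialFunctions.Trigonometric.Bounds
import Mathlib.Analysis.Complex.Exponential
import Literature.NumberTheory.LFunctions.KeiperLiPositivityUpTo
import Literature.NumberTheory.LFunctions.SchoenfeldZeroSums
import Summits.RiemannHypothesis.RiemannHypothesis.Theorems.LiCoefficientsLiBoxSplitPair
import HarnessLib

/-!
# RiemannHypothesis / LiAsymptotic — crux `LiBoxTwoSided`, part 1 (RH-FREE): the angle lemma and the
# two-sided far pair

RH-FREE [rh-li-prover].  Crux K1 of the rung L-P(P1⁺) «Li asymptotic law, quadratic range» (route dossier `LiAsymptotic`,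
cell `pub/rh-li`, theory memo `theory/TARGETS.md` §11.2 STEP 2), part 1 — the termwise TWO-SIDED far-pair lemma
(`pair_two_sided`): for `0 ≤ Re ρ ≤ 1`, `Im ρ = γ ≥ 4` and `n ≤ γ²/4` the reflected pair `{ρ, 1 − ρ̄}` of the
Bombieri–Lagarias zero sum contributes `2 f_n(γ)` up to `2.82 n²/γ⁴ + n/(2γ³)`:

  `|Re(1 − (1 − 1/ρ)ⁿ) + Re(1 − (1 − 1/(1 − ρ̄))ⁿ) − 2 f_n(γ)| ≤ 2.82 n²/γ⁴ + n/(2γ³)`,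

`f_n(t) = 1 − cos(n θ(t))`, `θ(t) = 2 arctan(1/2t)` (`liWindowWeight`, `liZeroAngle`).  With `x + iy = n log w`,
`w = 1 − 1/ρ`, `1 − 1/(1 − ρ̄) = 1/w̄`, the pair is `2 − 2 cosh x cos y`, so
`|pair − 2 f_n(γ)| ≤ 2(cosh x − 1) + 2|cos y − cos nθ(γ)|`; the first term is `≤ 2.82 n²/|ρ|⁴` by the tree's
`two_mul_cosh_sub_one_le` (exactly as in the one-sided `far_pair_lower` of route `LiCoefficients`), the second is
`≤ n/(2γ³)` by the ANGLE LEMMA `|arg w − θ(γ)| ≤ (Re ρ − ½)²/γ³ ≤ 1/(4γ³)` (`abs_arg_one_sub_inv_sub_liZeroAngle_le`: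
`arg w = arctan(γ/(|ρ|² − Re ρ))`, `|ρ|² − Re ρ = γ² − ¼ + (Re ρ − ½)²`, `θ(γ) = arctan(γ/(γ² − ¼))` by
`Real.two_mul_arctan`, and `0 ≤ arctan a − arctan b ≤ (a − b)/(1 + b²)` for `0 < b ≤ a`).

Part 2 (`LiAsymptoticBoxTwoSided.lean`) sums this over the zeros above the verified height.  Nothing here bears on
the truth of RH: no hypothesis on the real parts of the zeros is made in this file at all.
-/

noncomputable section

-- D-0017: `Summit.<S>.<S>.…` is the designed namespace of a single-problem summit.
set_option linter.dupNamespace false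

open Complex Filter Set
open scoped Real ComplexConjugate Topology

namespace Summit.RiemannHypothesis.RiemannHypothesis.Theorems.LiTheory

open Literature.NumberTheory.LFunctions Literature.NumberTheory.LFunctions.SchoenfeldBound
open Literature.NumberTheory.DiophantineGeometry

namespace BoxSplit

/-! ### The angle lemma -/

/-- For `0 < b ≤ a`: `0 ≤ arctan a − arctan b ≤ (a − b)/(1 + b²)`
(`arctan a − arctan b = arctan((a − b)/(1 + ab))`, `arctan u ≤ u` for `u ≥ 0`, `ab ≥ b²`). -/
theorem arctan_sub_arctan_le {a b : ℝ} (hb : 0 < b) (hba : b ≤ a) :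
    0 ≤ Real.arctan a - Real.arctan b ∧ Real.arctan a - Real.arctan b ≤ (a - b) / (1 + b ^ 2) := by
  have ha : 0 < a := hb.trans_le hba
  refine ⟨by linarith [Real.arctan_le_arctan_iff.2 hba], ?_⟩
  have hadd : Real.arctan a + Real.arctan (-b) = Real.arctan ((a + -b) / (1 - a * -b)) :=
    Real.arctan_add (by nlinarith)
  rw [Real.arctan_neg] at hadd
  rw [sub_eq_add_neg, hadd]
  set u := (a + -b) / (1 - a * -b) with hu
  have hu0 : 0 ≤ u := by rw [hu]; exact div_nonneg (by linarith) (by nlinarith)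
  have h1 : Real.arctan u ≤ u := by
    have h := Real.le_tan (Real.arctan_nonneg.2 hu0) (Real.arctan_lt_pi_div_two u)
    rwa [Real.tan_arctan] at h
  have h2 : u ≤ (a - b) / (1 + b ^ 2) := by
    rw [hu, div_le_div_iff₀ (by nlinarith) (by positivity)]
    have : 0 ≤ a - b := by linarith
    nlinarith [mul_nonneg this (mul_nonneg hb.le (sub_nonneg.2 hba))]
  linarith

/-- `θ(γ) = 2 arctan(1/2γ) = arctan(γ/(γ² − ¼))` for `γ > ½`. -/
theorem liZeroAngle_eq_arctan {γ : ℝ} (hγ : 1 / 2 < γ) :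
    liZeroAngle γ = Real.arctan (γ / (γ ^ 2 - 1 / 4)) := by
  have hγ0 : 0 < γ := by linarith
  have hx1 : 1 / (2 * γ) < 1 := by rw [div_lt_one (by positivity)]; linarith
  have hx0 : 0 < 1 / (2 * γ) := by positivity
  rw [liZeroAngle, Real.two_mul_arctan (by linarith) hx1]
  congr 1
  have h4 : (4 : ℝ) * γ ^ 2 - 1 ≠ 0 := by nlinarith
  have hq : γ ^ 2 - 1 / 4 ≠ 0 := by nlinarith
  field_simp
  ring

/-- Real and imaginary parts of `w = 1 − 1/ρ`: `Re w = (|ρ|² − Re ρ)/|ρ|²`, `Im w = Im ρ/|ρ|²`. -/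
theorem one_sub_inv_re_im {ρ : ℂ} (hρ : ρ ≠ 0) :
    (1 - 1 / ρ).re = (Complex.normSq ρ - ρ.re) / Complex.normSq ρ ∧
      (1 - 1 / ρ).im = ρ.im / Complex.normSq ρ := by
  have hN : Complex.normSq ρ ≠ 0 := (Complex.normSq_pos.2 hρ).ne'
  constructor
  · rw [Complex.sub_re, Complex.one_re, one_div, Complex.inv_re]
    field_simp
  · rw [Complex.sub_im, Complex.one_im, one_div, Complex.inv_im]
    field_simp
    ring

set_option maxHeartbeats 400000 in
/-- **The angle lemma.**  For `0 ≤ Re ρ ≤ 1` and `Im ρ = γ ≥ 4`: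
`|arg(1 − 1/ρ) − θ(γ)| ≤ (Re ρ − ½)²/γ³` (`arg(1 − 1/ρ) = arctan(γ/(|ρ|² − Re ρ))`,
`|ρ|² − Re ρ = γ² − ¼ + (Re ρ − ½)²`, `θ(γ) = arctan(γ/(γ² − ¼))`, and `arctan_sub_arctan_le`). -/
theorem abs_arg_one_sub_inv_sub_liZeroAngle_le {ρ : ℂ} (h0 : 0 ≤ ρ.re) (h1 : ρ.re ≤ 1) (h4 : 4 ≤ ρ.im) :
    |Complex.arg (1 - 1 / ρ) - liZeroAngle ρ.im| ≤ (ρ.re - 1 / 2) ^ 2 / ρ.im ^ 3 := by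
  set β := ρ.re with hβ
  set γ := ρ.im with hγ
  set q := (β - 1 / 2) ^ 2 with hq
  have hγ0 : 0 < γ := by linarith
  have hρ0 : ρ ≠ 0 := fun h ↦ by rw [h, Complex.zero_im] at hγ; linarith
  have hN : Complex.normSq ρ = β ^ 2 + γ ^ 2 := by rw [Complex.normSq_apply]; ring
  have hq0 : 0 ≤ q := sq_nonneg _
  have hq4 : q ≤ 1 / 4 := by rw [hq]; nlinarith
  have hD : Complex.normSq ρ - β = γ ^ 2 - 1 / 4 + q := by rw [hN, hq]; ring
  have hDpos : 0 < γ ^ 2 - 1 / 4 + q := by nlinarith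
  obtain ⟨hre, him⟩ := one_sub_inv_re_im hρ0
  rw [← hβ] at hre
  rw [← hγ] at him
  have hNpos : 0 < Complex.normSq ρ := Complex.normSq_pos.2 hρ0
  -- `arg w = arctan(Im w/Re w)` since `Re w > 0`
  have hwre : 0 < (1 - 1 / ρ).re := by rw [hre, hD]; positivity
  have harg : Complex.arg (1 - 1 / ρ) = Real.arctan (γ / (γ ^ 2 - 1 / 4 + q)) := by
    have hlt := (Complex.abs_arg_lt_pi_div_two_iff.2 (Or.inl hwre))
    rw [abs_lt] at hlt
    rw [← Real.arctan_tan hlt.1 hlt.2, Complex.tan_arg, him, hre, hD]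
    congr 1
    field_simp
  rw [harg, liZeroAngle_eq_arctan (by linarith)]
  -- `b = γ/(γ² − ¼ + q) ≤ a = γ/(γ² − ¼)`
  set a := γ / (γ ^ 2 - 1 / 4) with ha
  set b := γ / (γ ^ 2 - 1 / 4 + q) with hb
  have hA : 0 < γ ^ 2 - 1 / 4 := by nlinarith
  have hb0 : 0 < b := by positivity
  have hba : b ≤ a := by
    rw [ha, hb]; exact div_le_div_of_nonneg_left hγ0.le hA (by linarith)
  obtain ⟨hl, hu⟩ := arctan_sub_arctan_le hb0 hba
  rw [abs_sub_comm, abs_of_nonneg hl]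
  refine hu.trans ?_
  -- `(a − b)/(1 + b²) ≤ q/γ³`
  have hA' : γ ^ 2 - 1 / 4 ≠ 0 := hA.ne'
  have hD' : γ ^ 2 - 1 / 4 + q ≠ 0 := hDpos.ne'
  have hab : a - b = γ * q / ((γ ^ 2 - 1 / 4) * (γ ^ 2 - 1 / 4 + q)) := by
    rw [ha, hb, div_sub_div _ _ hA' hD']
    congr 1
    ring
  have hbge : 1 / γ ≤ b := by
    rw [hb, div_le_div_iff₀ hγ0 hDpos]; nlinarith
  have h1b : 1 + (1 / γ) ^ 2 ≤ 1 + b ^ 2 := by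
    have := pow_le_pow_left₀ (by positivity) hbge 2
    linarith
  have hab0 : 0 ≤ a - b := by linarith
  calc (a - b) / (1 + b ^ 2) ≤ (a - b) / (1 + (1 / γ) ^ 2) :=
        div_le_div_of_nonneg_left hab0 (by positivity) h1b
    _ ≤ (γ * q / ((γ ^ 2 - 1 / 4) * (γ ^ 2 - 1 / 4))) / (1 + (1 / γ) ^ 2) := by
        refine div_le_div_of_nonneg_right ?_ (by positivity)
        rw [hab]
        refine div_le_div_of_nonneg_left (mul_nonneg hγ0.le hq0) (by positivity) ?_
        exact mul_le_mul_of_nonneg_left (by linarith) hA.le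
    _ ≤ q / γ ^ 3 := by
        rw [div_div, div_le_div_iff₀ (by positivity) (by positivity)]
        have hγ16 : 16 ≤ γ ^ 2 := by nlinarith
        have key : γ * γ ^ 3 ≤ (γ ^ 2 - 1 / 4) * (γ ^ 2 - 1 / 4) * (1 + (1 / γ) ^ 2) := by
          have e : (γ ^ 2 - 1 / 4) * (γ ^ 2 - 1 / 4) * (1 + (1 / γ) ^ 2) =
              (γ ^ 2 - 1 / 4) ^ 2 + (γ ^ 2 - 1 / 4) ^ 2 / γ ^ 2 := by
            field_simp
          rw [e]
          have h2 : (γ ^ 2 - 1 / 4) ^ 2 / γ ^ 2 ≥ γ ^ 2 / 2 := by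
            rw [ge_iff_le, le_div_iff₀ (by positivity)]; nlinarith
          nlinarith
        calc γ * q * γ ^ 3 = q * (γ * γ ^ 3) := by ring
          _ ≤ q * ((γ ^ 2 - 1 / 4) * (γ ^ 2 - 1 / 4) * (1 + (1 / γ) ^ 2)) :=
              mul_le_mul_of_nonneg_left key hq0

/-! ### The two-sided pair -/

/-- **K1a (the two-sided far pair).**  For `0 ≤ Re ρ ≤ 1`, `Im ρ = γ ≥ 4` and `n ≤ γ²/4`, the reflected pair
`{ρ, 1 − ρ̄}` contributes `2 f_n(γ)` up to `2.82 n²/γ⁴ + n/(2γ³)`: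
`|Re(1 − (1 − 1/ρ)ⁿ) + Re(1 − (1 − 1/(1 − ρ̄))ⁿ) − 2 f_n(γ)| ≤ 2.82 n²/γ⁴ + n/(2γ³)`. -/
theorem pair_two_sided (n : ℕ) {ρ : ℂ} (h0 : 0 ≤ ρ.re) (h1 : ρ.re ≤ 1) (h4 : 4 ≤ ρ.im)
    (hn : (n : ℝ) ≤ ρ.im ^ 2 / 4) :
    |(1 - (1 - 1 / ρ) ^ n).re + (1 - (1 - 1 / (1 - conj ρ)) ^ n).re - 2 * liWindowWeight n ρ.im| ≤
      2.82 * (n : ℝ) ^ 2 / ρ.im ^ 4 + (n : ℝ) / (2 * ρ.im ^ 3) := by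
  set γ := ρ.im with hγdef
  have hγpos : 0 < γ := by linarith
  -- purely real preliminaries (before the complex bookkeeping enters the context)
  have hq4 : (ρ.re - 1 / 2) ^ 2 / γ ^ 3 ≤ 1 / (4 * γ ^ 3) := by
    rw [div_le_div_iff₀ (by positivity) (by positivity)]
    have hsq : (ρ.re - 1 / 2) ^ 2 ≤ 1 / 4 := by nlinarith [mul_nonneg h0 (sub_nonneg.2 h1)]
    have hγ3 : 0 < γ ^ 3 := by positivity
    nlinarith
  have hγnorm : γ ≤ ‖ρ‖ := le_trans (le_abs_self _) (Complex.abs_im_le_norm ρ)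
  have hnorm4 : (4 : ℝ) ≤ ‖ρ‖ := h4.trans hγnorm
  have hnorm_pos : 0 < ‖ρ‖ := by linarith
  have hρ0 : ρ ≠ 0 := norm_pos_iff.1 hnorm_pos
  have hρ1 : ρ ≠ 1 := by
    intro h; rw [h, norm_one] at hnorm4; norm_num at hnorm4
  -- the norm square `N = |ρ|²`
  obtain ⟨N, hN⟩ : ∃ N : ℝ, Complex.normSq ρ = N := ⟨_, rfl⟩
  have hNeq' : N = ‖ρ‖ ^ 2 := by rw [← hN, Complex.normSq_eq_norm_sq]
  have hγ2N : γ ^ 2 ≤ N := by rw [hNeq']; nlinarith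
  have hγ4N : γ ^ 4 ≤ N ^ 2 := by nlinarith
  have hN16 : 16 ≤ N := by nlinarith
  have hNpos : 0 < N := by linarith
  have hn' : (n : ℝ) ≤ ‖ρ‖ ^ 2 / 4 := by rw [← hNeq']; linarith
  -- `ε = ρ⁻¹`
  have hεsq : ‖ρ⁻¹‖ ^ 2 = N⁻¹ := by rw [Complex.sq_norm, Complex.normSq_inv, hN]
  have hε2le : ‖ρ⁻¹‖ ^ 2 ≤ 1 / 16 := by
    rw [hεsq, one_div, inv_le_inv₀ hNpos (by norm_num)]
    exact hN16
  have hεle : ‖ρ⁻¹‖ ≤ 1 / 4 := by nlinarith [norm_nonneg ρ⁻¹]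
  have hεlt1 : ‖ρ⁻¹‖ < 1 := by linarith
  have hw0 : (1 : ℂ) - ρ⁻¹ ≠ 0 := by
    intro h
    have h' : ‖(ρ⁻¹ : ℂ)‖ = 1 := by rw [← sub_eq_zero.1 h]; simp
    linarith
  obtain ⟨L, hL⟩ : ∃ L : ℂ, Complex.log (1 - ρ⁻¹) = L := ⟨_, rfl⟩
  have hexpL : Complex.exp L = 1 - ρ⁻¹ := by rw [← hL]; exact Complex.exp_log hw0
  have hwn : (1 - 1 / ρ) ^ n = Complex.exp (n * L) := by
    rw [Complex.exp_nat_mul, hexpL, one_div]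
  have hc0 : conj ρ ≠ 0 := fun h ↦ hρ0 (by simpa using congrArg conj h)
  have hc1 : conj ρ ≠ 1 := fun h ↦ hρ1 (by simpa using congrArg conj h)
  have hw'n : (1 - 1 / (1 - conj ρ)) ^ n = conj (Complex.exp (-(n * L))) := by
    rw [Complex.exp_neg, Complex.exp_nat_mul, hexpL, map_inv₀, map_pow, map_sub, map_one,
      map_inv₀, ← inv_pow, one_sub_one_div_one_sub_eq hc0 hc1]
  have hnL_re : ((n : ℂ) * L).re = n * L.re := by simp [Complex.mul_re]
  have hnL_im : ((n : ℂ) * L).im = n * L.im := by simp [Complex.mul_im]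
  have hre1 : ((1 - 1 / ρ) ^ n).re = Real.exp (n * L.re) * Real.cos (n * L.im) := by
    rw [hwn, Complex.exp_re, hnL_re, hnL_im]
  have hre2 : ((1 - 1 / (1 - conj ρ)) ^ n).re =
      Real.exp (-(n * L.re)) * Real.cos (n * L.im) := by
    rw [hw'n, Complex.conj_re, Complex.exp_re, Complex.neg_re, Complex.neg_im, hnL_re, hnL_im,
      Real.cos_neg]
  rw [Complex.sub_re, Complex.sub_re, Complex.one_re, hre1, hre2]
  obtain ⟨x, hx⟩ : ∃ x : ℝ, (n : ℝ) * L.re = x := ⟨_, rfl⟩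
  obtain ⟨y, hy⟩ : ∃ y : ℝ, (n : ℝ) * L.im = y := ⟨_, rfl⟩
  rw [hx, hy]
  -- the logarithm: `L = -ρ⁻¹ + E`, `‖E‖ ≤ (2/3) N⁻¹`
  have hE : ‖L + ρ⁻¹‖ ≤ 2 / 3 * N⁻¹ := by
    have h := Complex.norm_log_one_add_sub_self_le (z := -ρ⁻¹) (by rwa [norm_neg])
    rw [norm_neg, ← sub_eq_add_neg, hL, sub_neg_eq_add] at h
    have hinv : (1 - ‖(ρ⁻¹ : ℂ)‖)⁻¹ ≤ 4 / 3 := by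
      have h43 : (4 / 3 : ℝ)⁻¹ = 3 / 4 := by norm_num
      rw [inv_le_comm₀ (by linarith) (by norm_num), h43]
      linarith
    calc ‖L + ρ⁻¹‖ ≤ ‖(ρ⁻¹ : ℂ)‖ ^ 2 * (1 - ‖(ρ⁻¹ : ℂ)‖)⁻¹ / 2 := h
      _ ≤ ‖(ρ⁻¹ : ℂ)‖ ^ 2 * (4 / 3) / 2 := by gcongr
      _ = 2 / 3 * N⁻¹ := by rw [hεsq]; ring
  have hLre : |L.re| ≤ 5 / 3 * N⁻¹ := by
    have h1' : |(L + ρ⁻¹).re| ≤ 2 / 3 * N⁻¹ := (Complex.abs_re_le_norm _).trans hE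
    rw [Complex.add_re, Complex.inv_re, hN] at h1'
    have h2 : 0 ≤ ρ.re / N := div_nonneg h0 hNpos.le
    have h3 : ρ.re / N ≤ N⁻¹ := by
      rw [div_le_iff₀ hNpos, inv_mul_cancel₀ hNpos.ne']
      exact h1
    have h4' := abs_le.1 h1'
    rw [abs_le]
    constructor <;> linarith [h4'.1, h4'.2]
  -- `|x| ≤ (5/3) n/N ≤ 5/12`
  have hn0' : (0 : ℝ) ≤ n := n.cast_nonneg
  have hu : (n : ℝ) / N ≤ 1 / 4 := by
    rw [div_le_iff₀ hNpos, hNeq']; linarith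
  have hxb : |x| ≤ 5 / 3 * (n / N) := by
    rw [← hx, abs_mul, Nat.abs_cast]
    calc (n : ℝ) * |L.re| ≤ n * (5 / 3 * N⁻¹) := mul_le_mul_of_nonneg_left hLre hn0'
      _ = 5 / 3 * (n / N) := by ring
  have hx512 : |x| ≤ 5 / 12 := hxb.trans (by linarith)
  have hcosh := two_mul_cosh_sub_one_le hx512
  -- `x² ≤ (25/9)(n/N)²` and `(n/N)² ≤ n²/γ⁴`
  have hx2 : x ^ 2 ≤ 25 / 9 * ((n : ℝ) / N) ^ 2 := by
    have h := pow_le_pow_left₀ (abs_nonneg x) hxb 2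
    rw [sq_abs, mul_pow] at h
    norm_num at h
    exact h
  have hfrac : ((n : ℝ) / N) ^ 2 ≤ (n : ℝ) ^ 2 / γ ^ 4 := by
    rw [div_pow]
    exact div_le_div_of_nonneg_left (by positivity) (by positivity) hγ4N
  have hBpos : (0 : ℝ) ≤ (n : ℝ) ^ 2 / γ ^ 4 := by positivity
  have hcosh' : 2 * (Real.cosh x - 1) ≤ 2.82 * (n : ℝ) ^ 2 / γ ^ 4 := by
    have : 2.82 * (n : ℝ) ^ 2 / γ ^ 4 = 2.82 * ((n : ℝ) ^ 2 / γ ^ 4) := by ring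
    rw [this]
    linarith [hx2, hfrac, hcosh, hBpos]
  have hcosh0 : 0 ≤ Real.cosh x - 1 := by linarith [Real.one_le_cosh x]
  -- the angle: `|y − n θ(γ)| ≤ n/(4γ³)`
  have hLim : L.im = Complex.arg (1 - 1 / ρ) := by rw [← hL, Complex.log_im, one_div]
  have hangle := abs_arg_one_sub_inv_sub_liZeroAngle_le h0 h1 h4
  have hyθ : |y - n * liZeroAngle γ| ≤ n / (4 * γ ^ 3) := by
    rw [← hy, hLim, ← mul_sub, abs_mul, Nat.abs_cast]
    calc (n : ℝ) * |Complex.arg (1 - 1 / ρ) - liZeroAngle γ| ≤ n * (1 / (4 * γ ^ 3)) :=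
          mul_le_mul_of_nonneg_left (hangle.trans hq4) hn0'
      _ = n / (4 * γ ^ 3) := by ring
  have hcos := Real.abs_cos_sub_cos_le y (n * liZeroAngle γ)
  -- assemble: the expression is `2(cos nθ − cos y) − 2(cosh x − 1) cos y`
  have hexpr : 1 - Real.exp x * Real.cos y + (1 - Real.exp (-x) * Real.cos y) - 2 * liWindowWeight n γ =
      -2 * (Real.cos y - Real.cos (n * liZeroAngle γ)) - 2 * (Real.cosh x - 1) * Real.cos y := by
    rw [liWindowWeight, Real.cosh_eq]; ring
  rw [hexpr]
  have hcy := Real.abs_cos_le_one y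
  have t1 : |-2 * (Real.cos y - Real.cos (n * liZeroAngle γ))| ≤ (n : ℝ) / (2 * γ ^ 3) := by
    rw [abs_mul, show |(-2 : ℝ)| = 2 by norm_num]
    have := hcos.trans hyθ
    have e : (n : ℝ) / (2 * γ ^ 3) = 2 * (n / (4 * γ ^ 3)) := by ring
    rw [e]
    exact mul_le_mul_of_nonneg_left this (by norm_num)
  have t2 : |2 * (Real.cosh x - 1) * Real.cos y| ≤ 2.82 * (n : ℝ) ^ 2 / γ ^ 4 := by
    rw [abs_mul, abs_of_nonneg (by linarith : (0 : ℝ) ≤ 2 * (Real.cosh x - 1))]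
    calc 2 * (Real.cosh x - 1) * |Real.cos y| ≤ 2 * (Real.cosh x - 1) * 1 :=
          mul_le_mul_of_nonneg_left hcy (by linarith)
      _ ≤ 2.82 * (n : ℝ) ^ 2 / γ ^ 4 := by linarith
  calc |-2 * (Real.cos y - Real.cos (n * liZeroAngle γ)) - 2 * (Real.cosh x - 1) * Real.cos y|
      ≤ |-2 * (Real.cos y - Real.cos (n * liZeroAngle γ))| + |2 * (Real.cosh x - 1) * Real.cos y| :=
        abs_sub _ _
    _ ≤ (n : ℝ) / (2 * γ ^ 3) + 2.82 * (n : ℝ) ^ 2 / γ ^ 4 := add_le_add t1 t2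
    _ = 2.82 * (n : ℝ) ^ 2 / γ ^ 4 + (n : ℝ) / (2 * γ ^ 3) := add_comm _ _

end BoxSplit

end Summit.RiemannHypothesis.RiemannHypothesis.Theorems.LiTheory

end
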